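import Summits.Langlands.Langlands.Theorems.SqrtFiveQuarticCoversBorelThreeHauptmodul

/-!
# Route `SqrtFiveQuarticCovers`, crux `BoxBorelFive` (stmt-Langlands-17835): the algebra of the
# `X₀(5)` hauptmodul — Tate-normal-form identities and `j = (h² + 10h + 5)³/h` at a `5`-division root

`BoxBorelFive`'s central hypothesis is a Borel mod-`5` framing (`b5`): a `K`-rational `5`-isogeny, i.e.
a `K`-point of `X₀(5) = X(b5)`, the common factor of Box's four `b5`-curves `X₀(105)`, `X(s3,b5,b7)`,
`X(b3,b5,e7)`, `X(s3,b5,e7)` (Box 2022 Thm. 1.5).  This file is the ALGEBRAIC CORE of the level-`5`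
analogue of the level-`3` bricks (p799099 `X₀(3)`, p800188 `X_s⁺(3)`): for a Weierstrass curve `W` and
an abscissa `x`, write

  `τ = 6x² + b₂x + b₄`, `υ = 4x³ + b₂x² + 2b₄x + b₆ (= ψ₂²)`, `w = Ψ₃(x) = 3x⁴ + b₂x³ + 3b₄x² + 3b₆x + b₈`,
  `P₄ = τ·w − υ²` (Mathlib's `preΨ₄` evaluated at `x`).

* UNIVERSAL identities (any commutative ring, any `x`; integer cofactors of the `b`-relation):
  `c₄_mul_upsilon_sq`: `c₄·υ² = (τ² + 4w)² − 24τυ²`; `Δ_mul_upsilon_sq`: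
  `Δ·υ² = −(τ²+4w)²w − 8τ³υ² − 27υ⁴ + 9τ(τ²+4w)υ²` (these say: moving `(x, y)` to the origin with
  horizontal tangent by a `u = 1` isomorphism gives `y² + (τ/g)xy + g·y = x³ + (w/υ)x²`, `g² = υ`, whose
  `c₄, Δ` are those displayed); `tau_sq_add_four_Ψ₃`: `τ² + 4w = (12x + b₂)·υ`;
  the DOUBLING identities `upsilon_double`, `Ψ₃_double`: with `X₂ := x·υ − w` (so that
  `x(2P) = X₂/υ`, the tree's `addX_self_sub_mul_sq`), `4X₂³ + b₂X₂²υ + 2b₄X₂υ² + b₆υ³ = P₄²` and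
  `3X₂⁴ + b₂X₂³υ + 3b₄X₂²υ² + 3b₆X₂υ³ + b₈υ⁴ = w·(P₄υ² − w³ − P₄²)` (i.e. `ψ₂(2P)² = ψ₄²/ψ₂⁸`,
  `ψ₃(2P) = ψ₆/ψ₂⁹`);
* the `5`-DIVISION RELATION is `Ψ₅(x) = P₄υ² − w³ = 0` (Mathlib: `preΨ' 5 = preΨ₄·Ψ₂Sq² − Ψ₃³`), and in
  the Tate normal form `E_v : y² + (1−v)xy − vy = x³ − vx²` one has `v = −w³/υ⁴ = 1 − τw/υ²` and the
  `X₀(5)` hauptmodul `h = v − 11 − 1/v`;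
* `X0_five_atom_identity`: if `τ·w·υ² = υ⁴ + w³` then, with `Hn = τ(υ⁴ − w³) − 11w²υ²`, `Hd = w²υ²`:
  `((τ²+4w)² − 24τυ²)³·Hn·Hd⁵ = (Hn² + 10HnHd + 5Hd²)³·(Δ-expression)·υ⁴` (57-term integer cofactor);
* `exists_X0_five_hauptmodul_of_Ψ₅_relation` — over a field: `υ(x) ≠ 0`, `w(x) ≠ 0` and
  `P₄(x)υ(x)² = w(x)³` give `h ∈ K` (namely `h = τ(υ⁴ − w³)/(w²υ²) − 11`) with
  `c₄³·h = (h² + 10h + 5)³·Δ` — `j(W) = (h²+10h+5)³/h`, Klein's icosahedral / Fricke's `X₀(5) → X(1)`.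

The Galois side (`b5` framing ⇒ a point `P` of order `5` with `x(P)`, `x(2P)` fixed-or-swapped by
`Γ_K`, `Ψ₅(x(P)) = 0` from `x(4P) = x(P)` via `Ψ₃_double`/`upsilon_double`, and `h(x(2P)) = h(x(P))`)
is left to the successor file; the identities here are its complete algebraic input.  Everything is
proved; no named fact.  HONEST STATUS: helper of stmt-Langlands-17835 toward its N1 debt; closes no stub;
nothing here proves modularity of any curve.

References: J. Tate, *Algorithm for determining the type of a singular fiber* (LNM 476, 1975) §
(normal form); F. Klein, *Vorlesungen über das Ikosaeder* (1884); R. Fricke, *Die elliptischen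
Funktionen* II (1922) (`X₀(5)`); J. H. Silverman, GTM 106, III.§1, Ex. 3.7 (`ψₙ`, `[2]P`);
[Box2022] Thm. 1.5, §1.1.
-/

noncomputable section

set_option linter.dupNamespace false -- project-wide option (lakefile weak.linter.dupNamespace); `Summit.Langlands.Langlands` is the mandated namespace

open scoped Classical

namespace Summit.Langlands.Langlands.Theorems.SqrtFiveQuarticCovers

open WeierstrassCurve Polynomial

/-- `τ² + 4Ψ₃(x) = (12x + b₂)·υ(x)` — universal (the `b`-relation). [folklore] -/
theorem tau_sq_add_four_Ψ₃ {R : Type*} [CommRing R] (W : WeierstrassCurve R) (x : R) :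
    (6 * x ^ 2 + W.b₂ * x + W.b₄) ^ 2 + 4 * (3 * x ^ 4 + W.b₂ * x ^ 3 + 3 * W.b₄ * x ^ 2 + 3 * W.b₆ * x + W.b₈)
      = (12 * x + W.b₂) * (4 * x ^ 3 + W.b₂ * x ^ 2 + 2 * W.b₄ * x + W.b₆) := by
  linear_combination W.b_relation

/-- **`c₄·υ² = (τ² + 4Ψ₃)² − 24τυ²`** — universal (the invariant `c₄ = b₂'² − 24b₄'` of the model
`y² + (τ/g)xy + g·y = x³ + (Ψ₃/υ)x²`, `g² = υ`, reached by a `u = 1` isomorphism).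
[cite: SilvermanAEC2009, III.§1] -/
theorem c₄_mul_upsilon_sq {R : Type*} [CommRing R] (W : WeierstrassCurve R) (x : R) :
    W.c₄ * (4 * x ^ 3 + W.b₂ * x ^ 2 + 2 * W.b₄ * x + W.b₆) ^ 2 =
      ((6 * x ^ 2 + W.b₂ * x + W.b₄) ^ 2
          + 4 * (3 * x ^ 4 + W.b₂ * x ^ 3 + 3 * W.b₄ * x ^ 2 + 3 * W.b₆ * x + W.b₈)) ^ 2
        - 24 * (6 * x ^ 2 + W.b₂ * x + W.b₄) * (4 * x ^ 3 + W.b₂ * x ^ 2 + 2 * W.b₄ * x + W.b₆) ^ 2 := by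
  rw [WeierstrassCurve.c₄]
  linear_combination ((-96) * x ^ 4 + (-32) * W.b₂ * x ^ 3 + (-2) * W.b₂ ^ 2 * x ^ 2 + (-48) * W.b₄ * x ^ 2
    + (-4) * W.b₂ * W.b₄ * x + (-24) * W.b₆ * x - W.b₄ ^ 2 - W.b₂ * W.b₆ + (-4) * W.b₈) * W.b_relation

/-- **`Δ·υ² = −(τ²+4Ψ₃)²Ψ₃ − 8τ³υ² − 27υ⁴ + 9τ(τ²+4Ψ₃)υ²`** — universal (the discriminant of the same
model). [cite: SilvermanAEC2009, III.§1] -/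
theorem Δ_mul_upsilon_sq {R : Type*} [CommRing R] (W : WeierstrassCurve R) (x : R) :
    W.Δ * (4 * x ^ 3 + W.b₂ * x ^ 2 + 2 * W.b₄ * x + W.b₆) ^ 2 =
      -((6 * x ^ 2 + W.b₂ * x + W.b₄) ^ 2
          + 4 * (3 * x ^ 4 + W.b₂ * x ^ 3 + 3 * W.b₄ * x ^ 2 + 3 * W.b₆ * x + W.b₈)) ^ 2
          * (3 * x ^ 4 + W.b₂ * x ^ 3 + 3 * W.b₄ * x ^ 2 + 3 * W.b₆ * x + W.b₈)
        - 8 * (6 * x ^ 2 + W.b₂ * x + W.b₄) ^ 3 * (4 * x ^ 3 + W.b₂ * x ^ 2 + 2 * W.b₄ * x + W.b₆) ^ 2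
        - 27 * (4 * x ^ 3 + W.b₂ * x ^ 2 + 2 * W.b₄ * x + W.b₆) ^ 4
        + 9 * (6 * x ^ 2 + W.b₂ * x + W.b₄)
          * ((6 * x ^ 2 + W.b₂ * x + W.b₄) ^ 2
            + 4 * (3 * x ^ 4 + W.b₂ * x ^ 3 + 3 * W.b₄ * x ^ 2 + 3 * W.b₆ * x + W.b₈))
          * (4 * x ^ 3 + W.b₂ * x ^ 2 + 2 * W.b₄ * x + W.b₆) ^ 2 := by
  rw [WeierstrassCurve.Δ]
  linear_combination ((-4) * W.b₂ ^ 2 * x ^ 6 - W.b₂ ^ 3 * x ^ 5 + (-36) * W.b₂ * W.b₄ * x ^ 5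
    + (-11) * W.b₂ ^ 2 * W.b₄ * x ^ 4 + (216) * W.b₆ * x ^ 5 + (-69) * W.b₄ ^ 2 * x ^ 4
    + (63) * W.b₂ * W.b₆ * x ^ 4 + (-35) * W.b₂ * W.b₄ ^ 2 * x ^ 3 + W.b₂ ^ 2 * W.b₆ * x ^ 3
    + (108) * W.b₈ * x ^ 4 + (72) * W.b₄ * W.b₆ * x ^ 3 + (-33) * W.b₄ ^ 3 * x ^ 2
    + (36) * W.b₂ * W.b₈ * x ^ 3 + (-15) * W.b₂ * W.b₄ * W.b₆ * x ^ 2 + (2) * W.b₂ ^ 2 * W.b₈ * x ^ 2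
    + (54) * W.b₆ ^ 2 * x ^ 2 + (60) * W.b₄ * W.b₈ * x ^ 2 + (-33) * W.b₄ ^ 2 * W.b₆ * x
    + (4) * W.b₂ * W.b₄ * W.b₈ * x + (36) * W.b₆ * W.b₈ * x + (-9) * W.b₄ * W.b₆ ^ 2 + W.b₄ ^ 2 * W.b₈
    + W.b₂ * W.b₆ * W.b₈ + (4) * W.b₈ ^ 2) * W.b_relation

/-- **Doubling identity for `ψ₂²`**: with `X₂ = x·υ − Ψ₃` (so `x(2P) = X₂/υ`),
`4X₂³ + b₂X₂²υ + 2b₄X₂υ² + b₆υ³ = P₄²`, `P₄ = τΨ₃ − υ²` — i.e. `υ(x(2P))·υ³ = P₄²`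
(`ψ₂(2P)² = ψ₄²/ψ₂⁸`).  Universal. [cite: SilvermanAEC2009, Ex. 3.7] -/
theorem upsilon_double {R : Type*} [CommRing R] (W : WeierstrassCurve R) (x : R) :
    4 * (x * (4 * x ^ 3 + W.b₂ * x ^ 2 + 2 * W.b₄ * x + W.b₆)
          - (3 * x ^ 4 + W.b₂ * x ^ 3 + 3 * W.b₄ * x ^ 2 + 3 * W.b₆ * x + W.b₈)) ^ 3
      + W.b₂ * (x * (4 * x ^ 3 + W.b₂ * x ^ 2 + 2 * W.b₄ * x + W.b₆)
          - (3 * x ^ 4 + W.b₂ * x ^ 3 + 3 * W.b₄ * x ^ 2 + 3 * W.b₆ * x + W.b₈)) ^ 2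
          * (4 * x ^ 3 + W.b₂ * x ^ 2 + 2 * W.b₄ * x + W.b₆)
      + 2 * W.b₄ * (x * (4 * x ^ 3 + W.b₂ * x ^ 2 + 2 * W.b₄ * x + W.b₆)
          - (3 * x ^ 4 + W.b₂ * x ^ 3 + 3 * W.b₄ * x ^ 2 + 3 * W.b₆ * x + W.b₈))
          * (4 * x ^ 3 + W.b₂ * x ^ 2 + 2 * W.b₄ * x + W.b₆) ^ 2
      + W.b₆ * (4 * x ^ 3 + W.b₂ * x ^ 2 + 2 * W.b₄ * x + W.b₆) ^ 3 =
      ((6 * x ^ 2 + W.b₂ * x + W.b₄) * (3 * x ^ 4 + W.b₂ * x ^ 3 + 3 * W.b₄ * x ^ 2 + 3 * W.b₆ * x + W.b₈)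
        - (4 * x ^ 3 + W.b₂ * x ^ 2 + 2 * W.b₄ * x + W.b₆) ^ 2) ^ 2 := by
  linear_combination ((-9) * x ^ 8 + (-6) * W.b₂ * x ^ 7 - W.b₂ ^ 2 * x ^ 6 + (-18) * W.b₄ * x ^ 6
    + (-6) * W.b₂ * W.b₄ * x ^ 5 + (-18) * W.b₆ * x ^ 5 + (-9) * W.b₄ ^ 2 * x ^ 4 + (-6) * W.b₂ * W.b₆ * x ^ 4
    + (-6) * W.b₈ * x ^ 4 + (-18) * W.b₄ * W.b₆ * x ^ 3 + (-2) * W.b₂ * W.b₈ * x ^ 3 + (-9) * W.b₆ ^ 2 * x ^ 2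
    + (-6) * W.b₄ * W.b₈ * x ^ 2 + (-6) * W.b₆ * W.b₈ * x - W.b₈ ^ 2) * W.b_relation

/-- **Doubling identity for `Ψ₃`**: with `X₂ = x·υ − Ψ₃`,
`3X₂⁴ + b₂X₂³υ + 3b₄X₂²υ² + 3b₆X₂υ³ + b₈υ⁴ = Ψ₃·(P₄υ² − Ψ₃³ − P₄²)` — i.e.
`Ψ₃(x(2P))·υ⁴ = Ψ₃·(Ψ₅ − P₄²)` (`ψ₃(2P) = ψ₆/ψ₂⁹`, `ψ₆ = ψ₃(ψ₅ψ₂² − ψ₄²)/ψ₂`).  Universal.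
[cite: SilvermanAEC2009, Ex. 3.7] -/
theorem Ψ₃_double {R : Type*} [CommRing R] (W : WeierstrassCurve R) (x : R) :
    3 * (x * (4 * x ^ 3 + W.b₂ * x ^ 2 + 2 * W.b₄ * x + W.b₆)
          - (3 * x ^ 4 + W.b₂ * x ^ 3 + 3 * W.b₄ * x ^ 2 + 3 * W.b₆ * x + W.b₈)) ^ 4
      + W.b₂ * (x * (4 * x ^ 3 + W.b₂ * x ^ 2 + 2 * W.b₄ * x + W.b₆)
          - (3 * x ^ 4 + W.b₂ * x ^ 3 + 3 * W.b₄ * x ^ 2 + 3 * W.b₆ * x + W.b₈)) ^ 3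
          * (4 * x ^ 3 + W.b₂ * x ^ 2 + 2 * W.b₄ * x + W.b₆)
      + 3 * W.b₄ * (x * (4 * x ^ 3 + W.b₂ * x ^ 2 + 2 * W.b₄ * x + W.b₆)
          - (3 * x ^ 4 + W.b₂ * x ^ 3 + 3 * W.b₄ * x ^ 2 + 3 * W.b₆ * x + W.b₈)) ^ 2
          * (4 * x ^ 3 + W.b₂ * x ^ 2 + 2 * W.b₄ * x + W.b₆) ^ 2
      + 3 * W.b₆ * (x * (4 * x ^ 3 + W.b₂ * x ^ 2 + 2 * W.b₄ * x + W.b₆)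
          - (3 * x ^ 4 + W.b₂ * x ^ 3 + 3 * W.b₄ * x ^ 2 + 3 * W.b₆ * x + W.b₈))
          * (4 * x ^ 3 + W.b₂ * x ^ 2 + 2 * W.b₄ * x + W.b₆) ^ 3
      + W.b₈ * (4 * x ^ 3 + W.b₂ * x ^ 2 + 2 * W.b₄ * x + W.b₆) ^ 4 =
      (3 * x ^ 4 + W.b₂ * x ^ 3 + 3 * W.b₄ * x ^ 2 + 3 * W.b₆ * x + W.b₈) *
        (((6 * x ^ 2 + W.b₂ * x + W.b₄) * (3 * x ^ 4 + W.b₂ * x ^ 3 + 3 * W.b₄ * x ^ 2 + 3 * W.b₆ * x + W.b₈)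
            - (4 * x ^ 3 + W.b₂ * x ^ 2 + 2 * W.b₄ * x + W.b₆) ^ 2)
            * (4 * x ^ 3 + W.b₂ * x ^ 2 + 2 * W.b₄ * x + W.b₆) ^ 2
          - (3 * x ^ 4 + W.b₂ * x ^ 3 + 3 * W.b₄ * x ^ 2 + 3 * W.b₆ * x + W.b₈) ^ 3
          - ((6 * x ^ 2 + W.b₂ * x + W.b₄) * (3 * x ^ 4 + W.b₂ * x ^ 3 + 3 * W.b₄ * x ^ 2 + 3 * W.b₆ * x + W.b₈)
              - (4 * x ^ 3 + W.b₂ * x ^ 2 + 2 * W.b₄ * x + W.b₆) ^ 2) ^ 2) := by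
  linear_combination ((27) * x ^ 12 + (27) * W.b₂ * x ^ 11 + (9) * W.b₂ ^ 2 * x ^ 10 + W.b₂ ^ 3 * x ^ 9
    + (81) * W.b₄ * x ^ 10 + (54) * W.b₂ * W.b₄ * x ^ 9 + (9) * W.b₂ ^ 2 * W.b₄ * x ^ 8 + (81) * W.b₆ * x ^ 9
    + (81) * W.b₄ ^ 2 * x ^ 8 + (54) * W.b₂ * W.b₆ * x ^ 8 + (27) * W.b₂ * W.b₄ ^ 2 * x ^ 7
    + (9) * W.b₂ ^ 2 * W.b₆ * x ^ 7 + (27) * W.b₈ * x ^ 8 + (162) * W.b₄ * W.b₆ * x ^ 7 + (27) * W.b₄ ^ 3 * x ^ 6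
    + (18) * W.b₂ * W.b₈ * x ^ 7 + (54) * W.b₂ * W.b₄ * W.b₆ * x ^ 6 + (3) * W.b₂ ^ 2 * W.b₈ * x ^ 6
    + (81) * W.b₆ ^ 2 * x ^ 6 + (54) * W.b₄ * W.b₈ * x ^ 6 + (81) * W.b₄ ^ 2 * W.b₆ * x ^ 5
    + (27) * W.b₂ * W.b₆ ^ 2 * x ^ 5 + (18) * W.b₂ * W.b₄ * W.b₈ * x ^ 5 + (54) * W.b₆ * W.b₈ * x ^ 5
    + (81) * W.b₄ * W.b₆ ^ 2 * x ^ 4 + (27) * W.b₄ ^ 2 * W.b₈ * x ^ 4 + (18) * W.b₂ * W.b₆ * W.b₈ * x ^ 4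
    + (9) * W.b₈ ^ 2 * x ^ 4 + (27) * W.b₆ ^ 3 * x ^ 3 + (54) * W.b₄ * W.b₆ * W.b₈ * x ^ 3
    + (3) * W.b₂ * W.b₈ ^ 2 * x ^ 3 + (27) * W.b₆ ^ 2 * W.b₈ * x ^ 2 + (9) * W.b₄ * W.b₈ ^ 2 * x ^ 2
    + (9) * W.b₆ * W.b₈ ^ 2 * x + W.b₈ ^ 3) * W.b_relation

/-- **The `X₀(5)` identity in Tate atoms.**  Over any commutative ring: if `τ·w·υ² = υ⁴ + w³` (the
`5`-division relation `Ψ₅ = P₄υ² − w³ = 0`, `P₄ = τw − υ²`), then with `Hn = τ(υ⁴ − w³) − 11w²υ²`,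
`Hd = w²υ²`, `C = (τ²+4w)² − 24τυ²` (`= c₄υ²`) and `D = −(τ²+4w)²w − 8τ³υ² − 27υ⁴ + 9τ(τ²+4w)υ²`
(`= Δυ²`): `C³·Hn·Hd⁵ = (Hn² + 10HnHd + 5Hd²)³·D·υ⁴` (the relation `c₄³ h = (h²+10h+5)³ Δ` for
`h = Hn/Hd = v − 11 − 1/v`, `v = −w³/υ⁴`, read in the Tate normal form).  Explicit 57-term integer
cofactor. [folklore] -/
theorem X0_five_atom_identity {R : Type*} [CommRing R] {τ w υ : R}
    (hIII : τ * w * υ ^ 2 = υ ^ 4 + w ^ 3) :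
    ((τ ^ 2 + 4 * w) ^ 2 - 24 * τ * υ ^ 2) ^ 3 * (τ * (υ ^ 4 - w ^ 3) - 11 * w ^ 2 * υ ^ 2)
        * (w ^ 2 * υ ^ 2) ^ 5 =
      ((τ * (υ ^ 4 - w ^ 3) - 11 * w ^ 2 * υ ^ 2) ^ 2
          + 10 * (τ * (υ ^ 4 - w ^ 3) - 11 * w ^ 2 * υ ^ 2) * (w ^ 2 * υ ^ 2) + 5 * (w ^ 2 * υ ^ 2) ^ 2) ^ 3
        * (-(τ ^ 2 + 4 * w) ^ 2 * w - 8 * τ ^ 3 * υ ^ 2 - 27 * υ ^ 4 + 9 * τ * (τ ^ 2 + 4 * w) * υ ^ 2)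
        * υ ^ 4 := by
  linear_combination (τ ^ 9 * υ ^ 26 + (-27) * τ ^ 6 * υ ^ 28 + (9) * τ ^ 7 * w * υ ^ 26
    + (-35) * τ ^ 8 * w ^ 2 * υ ^ 24 + (-6) * τ ^ 9 * w ^ 3 * υ ^ 22 + (972) * τ ^ 5 * w ^ 2 * υ ^ 26
    + (-151) * τ ^ 6 * w ^ 3 * υ ^ 24 + (392) * τ ^ 7 * w ^ 4 * υ ^ 22 + (175) * τ ^ 8 * w ^ 5 * υ ^ 20
    + (16) * τ ^ 9 * w ^ 6 * υ ^ 18 + τ ^ 10 * w ^ 7 * υ ^ 16 + τ ^ 11 * w ^ 8 * υ ^ 14 + τ ^ 12 * w ^ 9 * υ ^ 12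
    + (-12960) * τ ^ 4 * w ^ 4 * υ ^ 24 + (-936) * τ ^ 5 * w ^ 5 * υ ^ 22 + (-1334) * τ ^ 6 * w ^ 6 * υ ^ 20
    + (-1666) * τ ^ 7 * w ^ 7 * υ ^ 18 + (-401) * τ ^ 8 * w ^ 8 * υ ^ 16 + (-77) * τ ^ 9 * w ^ 9 * υ ^ 14
    + (14) * τ ^ 10 * w ^ 10 * υ ^ 12 + (-11) * τ ^ 11 * w ^ 11 * υ ^ 10 - τ ^ 12 * w ^ 12 * υ ^ 8
    + (77760) * τ ^ 3 * w ^ 6 * υ ^ 22 + (31200) * τ ^ 4 * w ^ 7 * υ ^ 20 + (576) * τ ^ 5 * w ^ 8 * υ ^ 18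
    + (5570) * τ ^ 6 * w ^ 9 * υ ^ 16 + (1908) * τ ^ 7 * w ^ 10 * υ ^ 14 + (1101) * τ ^ 8 * w ^ 11 * υ ^ 12
    + (-199) * τ ^ 9 * w ^ 12 * υ ^ 10 + (-36) * τ ^ 10 * w ^ 13 * υ ^ 8 - τ ^ 11 * w ^ 14 * υ ^ 6
    + (-207360) * τ ^ 2 * w ^ 8 * υ ^ 20 + (-195840) * τ ^ 3 * w ^ 9 * υ ^ 18 + (-19872) * τ ^ 4 * w ^ 10 * υ ^ 16
    + (-9816) * τ ^ 5 * w ^ 11 * υ ^ 14 + (7089) * τ ^ 6 * w ^ 12 * υ ^ 12 + (-2663) * τ ^ 7 * w ^ 13 * υ ^ 10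
    + (-656) * τ ^ 8 * w ^ 14 * υ ^ 8 + (-43) * τ ^ 9 * w ^ 15 * υ ^ 6 - τ ^ 10 * w ^ 16 * υ ^ 4
    + (248832) * τ * w ^ 10 * υ ^ 18 + (416256) * τ ^ 2 * w ^ 11 * υ ^ 16 + (52288) * τ ^ 3 * w ^ 12 * υ ^ 14
    + (51552) * τ ^ 4 * w ^ 13 * υ ^ 12 + (-7116) * τ ^ 5 * w ^ 14 * υ ^ 10 + (-3035) * τ ^ 6 * w ^ 15 * υ ^ 8
    + (-268) * τ ^ 7 * w ^ 16 * υ ^ 6 + (-8) * τ ^ 8 * w ^ 17 * υ ^ 4 + (-110592) * w ^ 12 * υ ^ 16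
    + (-313344) * τ * w ^ 13 * υ ^ 14 + (-69632) * τ ^ 2 * w ^ 14 * υ ^ 12 + (-39936) * τ ^ 3 * w ^ 15 * υ ^ 10
    + (-7680) * τ ^ 4 * w ^ 16 * υ ^ 8 + (-576) * τ ^ 5 * w ^ 17 * υ ^ 6 + (-16) * τ ^ 6 * w ^ 18 * υ ^ 4
    + (45056) * w ^ 15 * υ ^ 12 + (4096) * τ * w ^ 16 * υ ^ 10) * hIII

/-- Passing to the hauptmodul `h = Hn/Hd` (`Hd ≠ 0`). [folklore] -/
theorem X0_five_hauptmodul_div {L : Type*} [Field L] {c Δ Hn Hd : L} (hHd : Hd ≠ 0)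
    (h : c * Hn * Hd ^ 5 = (Hn ^ 2 + 10 * Hn * Hd + 5 * Hd ^ 2) ^ 3 * Δ) :
    c * (Hn / Hd) = ((Hn / Hd) ^ 2 + 10 * (Hn / Hd) + 5) ^ 3 * Δ := by
  set u := Hn / Hd with hu
  have hu' : Hn = u * Hd := by rw [hu, div_mul_cancel₀ _ hHd]
  have key : Hd ^ 6 * (c * u - (u ^ 2 + 10 * u + 5) ^ 3 * Δ) = 0 := by
    rw [hu'] at h
    linear_combination h
  have hHd6 : Hd ^ 6 ≠ 0 := pow_ne_zero 6 hHd
  have := (mul_eq_zero.1 key).resolve_left hHd6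
  linear_combination this

/-- **The hauptmodul of `X₀(5)` at a `5`-division abscissa.**  Let `W` be a Weierstrass curve over a
field and `x` an element with `υ(x) ≠ 0`, `Ψ₃(x) ≠ 0` and the `5`-division relation
`P₄(x)·υ(x)² = Ψ₃(x)³` (`Ψ₅(x) = 0`; e.g. `x = x(P)` for a point `P` of order `5`).  Then
`h := τ(υ⁴ − Ψ₃³)/(Ψ₃²υ²) − 11` satisfies `c₄(W)³·h = (h² + 10h + 5)³·Δ(W)`, i.e.
`j(W) = (h² + 10h + 5)³/h` — the uniformisation of `X₀(5) → X(1)` (`h = v − 11 − 1/v` for the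
Tate parameter `v = −Ψ₃³/υ⁴`).  Proof: `c₄_mul_upsilon_sq`, `Δ_mul_upsilon_sq`,
`X0_five_atom_identity`, cancellation of `υ⁶`, `X0_five_hauptmodul_div`.
[cite: SilvermanAEC2009, III.§1, Ex. 3.7] -/
theorem exists_X0_five_hauptmodul_of_Ψ₅_relation {L : Type*} [Field L] (W : WeierstrassCurve L) {x : L}
    (hυ : 4 * x ^ 3 + W.b₂ * x ^ 2 + 2 * W.b₄ * x + W.b₆ ≠ 0)
    (hw : 3 * x ^ 4 + W.b₂ * x ^ 3 + 3 * W.b₄ * x ^ 2 + 3 * W.b₆ * x + W.b₈ ≠ 0)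
    (h5 : ((6 * x ^ 2 + W.b₂ * x + W.b₄) * (3 * x ^ 4 + W.b₂ * x ^ 3 + 3 * W.b₄ * x ^ 2 + 3 * W.b₆ * x + W.b₈)
        - (4 * x ^ 3 + W.b₂ * x ^ 2 + 2 * W.b₄ * x + W.b₆) ^ 2)
        * (4 * x ^ 3 + W.b₂ * x ^ 2 + 2 * W.b₄ * x + W.b₆) ^ 2 =
      (3 * x ^ 4 + W.b₂ * x ^ 3 + 3 * W.b₄ * x ^ 2 + 3 * W.b₆ * x + W.b₈) ^ 3) :
    ∃ h : L, W.c₄ ^ 3 * h = (h ^ 2 + 10 * h + 5) ^ 3 * W.Δ := by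
  -- name the atoms
  obtain ⟨τ, hτ⟩ : ∃ τ : L, τ = 6 * x ^ 2 + W.b₂ * x + W.b₄ := ⟨_, rfl⟩
  obtain ⟨υ, hυd⟩ : ∃ υ : L, υ = 4 * x ^ 3 + W.b₂ * x ^ 2 + 2 * W.b₄ * x + W.b₆ := ⟨_, rfl⟩
  obtain ⟨w, hwd⟩ : ∃ w : L, w = 3 * x ^ 4 + W.b₂ * x ^ 3 + 3 * W.b₄ * x ^ 2 + 3 * W.b₆ * x + W.b₈ :=
    ⟨_, rfl⟩
  have hC := c₄_mul_upsilon_sq W x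
  have hD := Δ_mul_upsilon_sq W x
  rw [← hτ, ← hυd, ← hwd] at hC hD h5
  rw [← hυd] at hυ
  rw [← hwd] at hw
  have hIII : τ * w * υ ^ 2 = υ ^ 4 + w ^ 3 := by linear_combination h5
  have key := X0_five_atom_identity hIII
  rw [← hC, ← hD] at key
  -- cancel `υ⁶`
  have hυ6 : υ ^ 6 ≠ 0 := pow_ne_zero 6 hυ
  have key' : υ ^ 6 * (W.c₄ ^ 3 * (τ * (υ ^ 4 - w ^ 3) - 11 * w ^ 2 * υ ^ 2) * (w ^ 2 * υ ^ 2) ^ 5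
      - ((τ * (υ ^ 4 - w ^ 3) - 11 * w ^ 2 * υ ^ 2) ^ 2
          + 10 * (τ * (υ ^ 4 - w ^ 3) - 11 * w ^ 2 * υ ^ 2) * (w ^ 2 * υ ^ 2) + 5 * (w ^ 2 * υ ^ 2) ^ 2) ^ 3
          * W.Δ) = 0 := by
    linear_combination key
  have hcl := (mul_eq_zero.1 key').resolve_left hυ6
  have hHd : w ^ 2 * υ ^ 2 ≠ 0 := mul_ne_zero (pow_ne_zero 2 hw) (pow_ne_zero 2 hυ)
  have hmain := X0_five_hauptmodul_div (c := W.c₄ ^ 3) (Δ := W.Δ)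
    (Hn := τ * (υ ^ 4 - w ^ 3) - 11 * w ^ 2 * υ ^ 2) (Hd := w ^ 2 * υ ^ 2) hHd
    (by linear_combination hcl)
  exact ⟨_, hmain⟩

end Summit.Langlands.Langlands.Theorems.SqrtFiveQuarticCovers

end
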